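import Mathlib
import HarnessLib
import HarnessLib.Audit
import Summits.Langlands.Statement
import Literature.NumberTheory.Automorphic.EigenvarietyResGLn
import Literature.NumberTheory.Automorphic.LocalLanglandsDatumProofs
import Literature.NumberTheory.GaloisRepresentations.SteinbergVelocityPackage
import Summits.Langlands.Langlands.Theorems.GenericWDUnique
import HarnessLib.Audit.Status.Attr

/-!
Route: SteinbergVelocityDst

# Route SteinbergVelocityDst — maximal monodromy at v|p for torsion-built rho_pi over CM fields from
full infinitesimal weight velocity (N is the derivative of the family), gen 3: pinned
(phi,Gamma)-package, D_st target

Route SteinbergVelocityDst = GENERATION 3 of the weight-velocity line (card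
Langlands/Langlands/monodromy-from-weight-velocity; gen 2 =
route SteinbergWeightVelocity, CLOSED retired 2026-08-15T23:18Z by a parallel route-choice unit on
the packaging defects R1/R1b/R2 of its
crux WeightVelocity stmt-Langlands-13450 — every gen-2 content item was on-paper false or junk-true
over the un-pinned `PhiGammaModuleRobba` /
`EigenvarietyResGLn` interfaces; gen 1 = WeightVelocityMonodromy). The SAME mechanism, re-typed
junk-robustly over the definitions that
landed the same evening — `DrigArtinian` (D_rig over E[ε], Bellaïche–Chenevier equivalence),
`BergerDstOnPhiGamma` (`PhiGammaModuleRobbaLog`,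
Berger's D_cris/D_st/N) — and over the pinned package `SteinbergVelocityPackage` requested and
landed for it (p71301).
It suffices to show X = MaximalMonodromyDst: for K CM, π regular algebraic cuspidal on GL_n(𝔸_K) (n
≥ 2) with a Jacquet exponent at
every w ∣ p (accessibility — the R1 repair), ρ semisimple and C-Satake-compatible with π, v ∣ p in
the sector (n ≥ 3 ∨ 2[K_v:ℚ_p] ≤ [K:ℚ])
with π_v of Steinberg type, every finite coefficient field E₀/ℚ_p EMBEDDED in ℚ̄_p (plain type +
`Topology.IsEmbedding`, so that the items
elaborate at default heartbeats) and every E₀-model r_K of ρ, and EVERY triple (𝔇, 𝓐, 𝓒) =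
((φ,Γ_(K_v))-module datum with Berger's log
structure over E₀, D_rig over Artinian coefficients, relative rank-one data) satisfying the PINNED
PACKAGE
`𝔇.IsSteinbergVelocityPackage 𝓐 𝓒 [K_v:ℚ_p] f_v` (requested Literature notion
SteinbergVelocityPackage, planner draft attached to
defn-SteinbergVelocityPackage; = IsKPX ∧ HasTensorCompatibleDrig — the Kronecker clause, the pin
that kills the R2 reindexings
twistSwap/swap since a ⊗-compatible class bijection fixing 1 is Tannakian, i.e. an automorphism of
Γ_(K_v), duality or coefficient
conjugation, all harmless for the twist/dual-invariant phrasings below — ∧ 𝓐.IsFunctorial ∧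
𝓐.HasBCEquivalence ∧ 𝓐.HasRestrictionCompatibility (the second pin: D_rig of Res_(E₀[ε]/E₀) ρ̃ =
restriction
of scalars of 𝓐.DrigOver ρ̃, which forces any re-indexing of DrigOver by an automorphism of the
deformation functor to be a scalar) ∧
𝓒.IsCompatible ∧ HasPerfectSpecialPairing (Ding §3.1) ∧ 𝓒.HasColmezGreenbergStevens (first-order
CGS, Ding Thm 3.4) ∧ HasDingSteinbergDictionary f_v
("non-critical special SEMISTABLE D with no non-zero unramified class in any 𝓛(D)_i has N^(n-1) ≠ 0
on D_st(D)", §3.1 + Lemma 3.2)) —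
the conclusion: if D := D_rig(r_K|Γ_(K_v)) (in a basis U) is upper-triangular with parameters
𝓡(δ_j), special consecutive ratios, and SEMISTABLE, then N^(n-1) ≠ 0 on Berger's D_st(D). Every
(φ,Γ)-level hypothesis is a printed
theorem, so X is contentful exactly for the genuine data and vacuous (never false, never junk-true)
for junk data; the parameter δ is
quantified AFTER 𝔇 (nothing is pinned to eigenvariety data), the Galois side names NO eigenvariety
(the automorphic family enters only the
intended proof of the crux), and the target sits at the D_st level (retriage V1: the ∃Rec/WD(D_pst)
form was junk-true). The remainder
DstToLanglands (declared, NOT claimed) carries X to `Langlands`: the genuine Berger-compatible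
reciprocity data, the reduction of a
general Steinberg type St ⊗ χ to the semistable case by a global finite-order twist (Grunwald–Wang),
existence of the special triangulation
(semistable ⇒ trianguline), the upgrade maximal N ⇒ `LocalGlobalCompatibleAt` (AHTW2026 ss part +
GenericWDUnique + the C↔L twist), and
everything outside [K CM, regular, accessible, sector].
Lean: `∀ (K : Type) [Field K] [NumberField K] [NumberField.IsCMField K] (n : ℕ) (hcpt :
Literature.NumberTheory.Automorphic.isCompact_glFiniteIntegralLevel n K) (π :
Literature.NumberTheory.Automorphic.CuspidalAutomorphicRepData n K hcpt), 2 ≤ n →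
π.1.IsRegularAlgebraic → ∀ (p : ℕ) [Fact p.Prime] (ι : PadicAlgCl p ≃+* ℂ) (ρ :
Literature.NumberTheory.GaloisRepresentations.FramedGaloisRep K (PadicAlgCl p) n),
ρ.toGaloisRep.IsSemisimple → (∀ᶠ v : IsDedekindDomain.HeightOneSpectrum (NumberField.RingOfIntegers
K) in Filter.cofinite, ∀ α : Multiset ℂ, π.1.HasSatakeParamAt v α → ρ.IsUnramifiedAt v ∧
ρ.HasFrobCharpolyAt v (Literature.NumberTheory.Automorphic.arithFrobPolyOfSatake ι v.residueCard n
α)) → ∀ (v : IsDedekindDomain.HeightOneSpectrum (NumberField.RingOfIntegers K)) (hv : ((p : ℕ) :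
NumberField.RingOfIntegers K) ∈ v.asIdeal), (3 ≤ n ∨ 2 * (v.asIdeal.ramificationIdx ℤ *
v.asIdeal.inertiaDeg ℤ) ≤ Module.finrank ℚ K) → (∀ (L :
Literature.NumberTheory.Automorphic.LocalLanglandsDatum (v.adicCompletion K)) (πv :
Literature.NumberTheory.Automorphic.SmoothIrrep (Matrix.GeneralLinearGroup (Fin n) (v.adicCompletion
K))), π.1.HasLocalComponentAt v πv.ρ → ((L.recGL n (Literature.NumberTheory.Automorphic.IrrClass.mk
πv)).out.1).N ^ (n - 1) ≠ 0) → (∀ w : Literature.NumberTheory.Automorphic.PlacesOver K p, ∃ (πw :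
Literature.NumberTheory.Automorphic.SmoothIrrep (Matrix.GeneralLinearGroup (Fin n)
(w.1.adicCompletion K))) (χw : (Fin n → (w.1.adicCompletion K)ˣ) →* ℂˣ), π.1.HasLocalComponentAt w.1
πw.ρ ∧ Literature.NumberTheory.Automorphic.IsJacquetExponent πw χw) → ∀ (E₀ : Type) [Field E₀]
[TopologicalSpace E₀] [IsTopologicalRing E₀] [Algebra ℚ_[p] E₀] [Module.Finite ℚ_[p] E₀] (emb : E₀
→+* PadicAlgCl p) (hemb : Topology.IsEmbedding emb), (∀ x : ℚ_[p], emb (algebraMap ℚ_[p] E₀ x) =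
algebraMap ℚ_[p] (PadicAlgCl p) x) → ∀ (rK :
Literature.NumberTheory.GaloisRepresentations.FramedGaloisRep K E₀ n), (∃ P :
Matrix.GeneralLinearGroup (Fin n) (PadicAlgCl p),
Literature.NumberTheory.GaloisRepresentations.FramedRep.conj P (rK.baseChange emb hemb.continuous) =
ρ) → ∀ (𝔇 : Literature.NumberTheory.GaloisRepresentations.PhiGammaModuleRobbaLog.{0, 0, 0} p
(v.adicCompletion K) E₀) (𝓐 : 𝔇.DrigArtinian) (𝓒 : 𝔇.RelativeCharData), 𝔇.IsSteinbergVelocityPackage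
𝓐 𝓒 (v.asIdeal.ramificationIdx ℤ * v.asIdeal.inertiaDeg ℤ) (v.asIdeal.inertiaDeg ℤ) → ∀ (U :
Matrix.GeneralLinearGroup (Fin n) 𝔇.R) (δ : Fin n → ((v.adicCompletion K)ˣ →ₜ* E₀ˣ)) (h : ((𝔇.Drig
(rK.toLocal v)).conj U).IsTriangularWith (fun j => ((𝔇.ofChar (δ j)).α : 𝔇.R)) (fun j σ =>
((𝔇.ofChar (δ j)).c σ : 𝔇.R))), 𝔇.IsCyclotomic ((𝔇.Drig (rK.toLocal v)).conj U) → ((𝔇.Drig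
(rK.toLocal v)).conj U).toPhiGammaModule.IsContinuous → (∀ (i : ℕ) (hi : i + 1 < n), Module.finrank
E₀ (𝔇.H2 ((Literature.NumberTheory.GaloisRepresentations.PhiGammaModule.Triangulation.ofTriangular
((𝔇.Drig (rK.toLocal v)).conj U) (fun j => 𝔇.ofChar (δ j)) h).ratioParam i hi).toModule) = 1) →
𝔇.IsSemistable ((𝔇.Drig (rK.toLocal v)).conj U).toPhiGammaModule (v.asIdeal.inertiaDeg ℤ) → 𝔇.nDst
((𝔇.Drig (rK.toLocal v)).conj U).toPhiGammaModule ^ (n - 1) ≠ 0`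

## Assembly
closes := hR (hM hV hNS hST): SteinbergMechanism (support, provable now — its plumbing is
kernel-checked in the planner's SketchMech.lean,
attached as evidence) turns InfinitesimalWeightVelocity + NonSplitSteinbergGraded +
StrictSteinbergGraded into X using only the package
clauses (pairing, CGS, dictionary) and linear algebra; the declared remainder DstToLanglands carries
X to the summit constant. AssemblyG3 is
the same chain as a Prop (proved outright in Sketch.lean: assemblyG3_holds).

Rationale: WHY THIS LINE. MONODROMY IS THE SHADOW OF WEIGHT VELOCITY, and the shadow is already cast at first
order. For a consecutive graded pair of the
special triangulation of D = D_rig(ρ_π|K_v) the class c_i ∈ H¹(𝓡(δ_iδ_(i+1)⁻¹)) pairs perfectly with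
Hom(K_v^×,E) (dim d_v+1), 𝓛(D)_i = c_i^⊥
is a hyperplane when c_i ≠ 0, the pair is crystalline iff the unramified line Hom_∞ lies in 𝓛(D)_i
(Ding2019SimpleL §3.1, arXiv:1807.10862
p.24 READ), N^(n-1) ≠ 0 on D_st(D) iff no pair is crystalline (Lemma 3.2 READ), and the
Colmez–Greenberg–Stevens formula (Thm 3.4 READ;
Colmez2010Linvariants, GreenbergStevens1993) puts the gap derivative ψ_i of EVERY first-order
trianguline deformation of D inside 𝓛(D)_i,
while conversely every ψ ∈ 𝓛(D)_i is realised (Prop 3.5–3.6). Hence LOCALLY the restrictions to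
𝒪_v^× of the gap derivatives span all of
Hom(𝒪_v^×,E) iff Hom_∞ ⊄ 𝓛(D)_i iff the pair is non-crystalline: the only contentful statement is
GLOBAL — that the first-order
deformations of ρ_π COMING FROM Γ_K (the tangent space of the Res_(K/ℚ)GL_n eigenvariety at x(π),
HansenUniversalEigenvarieties2017,
JohanssonNewton2019, KedlayaPottharstXiao2014; or its Galois description through Poitou–Tate, crux
ideas derived-diamond-duality /
poitou-tate-velocity-split on stmt-13450) already achieve full gap velocity at v. That is crux
InfinitesimalWeightVelocity; with non-split
(crux) and strict (support) pieces the package clauses give X by linear algebra (SteinbergMechanism)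
— no automorphy lifting, no Shimura
variety, no purity. Imported area: p-adic Hodge theory in families ((φ,Γ)-cohomology, 𝓛-invariants).
Nearest print: arXiv:2603.18961
(Mar 2026) Rem 1.3–1.4, the p-ORDINARY / K = ℚ shadow under NALC. What gen 3 (this route) changes
w.r.t. the closed gen 2 is the TYPING, not the mechanism: one
pinned package ∀-quantified once, ⊗-compatibility as the pin (Tannaka), parameters after 𝔇, dual
numbers instead of formal arcs, D_st instead
of ∃Rec — see the planner's ROUTE-CHOICE.md / junk audit on stmt-13450.

RANKED CRUXES. #0 MaximalMonodromyDst (target) — X as in § Thesis. (why it might fail: if r_ι(π) is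
reducible (open, n ≥ 3) the semisimple ρ
is a sum and N^(n-1) = 0 at v although (A) holds with a non-semisimple ρ; n = 2 at 2[K_v:ℚ_p] >
[K:ℚ] has no budget (excluded); as typed it is
vacuous, not false, on junk data.) [AHTW2026, Ding2019SimpleL, BergerLaurent2002,
BarreraGrahamWilliams2026, BuzzardGeeLMS2014]
#2 InfinitesimalWeightVelocity (crux, the bet, GLOBAL) — in the setting of X, for every consecutive
pair (i,i+1) and every continuous additive
φ : 𝒪_(K_v)^× → E₀ there are finitely many GLOBAL first-order deformations ρ̃_k : Γ_K → GL_n(E₀[ε])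
of r_K whose D_rig at v (𝓐.DrigOver) is
upper-triangular with relative rank-one parameters 𝓡_(E₀[ε])(δ̃_(k,j)) lifting δ_j, and scalars c_k,
with φ = Σ c_k ψ_i(δ̃_k)|𝒪^×
(ψ_i(δ̃) = ε-part of δ̃_iδ̃_(i+1)⁻¹): the global tangent directions move the (v;i,i+1)-gap in all
d_v directions. Intended proof: Hansen's
eigenvariety through the accessible refined point x(π) (Newton's bound dim_x ≥ [K⁺:ℚ]n+1, l₀ =
[K⁺:ℚ](n-1)), étaleness/KPX interpolation of the
tangent space, transversality of the weight map at v; Galois reformulation: equality of two dual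
adjoint Selmer groups (derived-diamond-duality).
(why it might fail: the global tangent space may only fill a hyperplane of gap directions at v — a
dual Selmer class invisible away from v
(Leopoldt shape; higher Calegari–Mazur; arXiv:2603.18961 Rem 1.4 gets half the simple roots even
under NALC); zero slack for n = 2, d_v = [K⁺:ℚ].)
[BarreraGrahamWilliams2026, HansenUniversalEigenvarieties2017, JohanssonNewton2019,
KedlayaPottharstXiao2014, BellaicheChenevier2009,
Ding2019SimpleL, CalegariMazur2008, Rawson2024, GehrmannRosso2022]
#2' (RECOMMENDED, not filed — route-repair g3 2026-08-16) InfinitesimalWeightVelocityOfGaloisReps =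
GaloisRepOfRegularAlgebraic → InfinitesimalWeightVelocity as the staffed form of the bet: every
known proof path of #2 (eigenvariety tangent space + Chenevier determinant family; Poitou–Tate /
dual Selmer via automorphy lifting) needs the Galois representations r_ι(π') at OTHER classical
points than the given ρ, i.e. lang.S27 `exists_galoisRep_of_regularAlgebraic` (HLTT/Scholze/Varma,
XL), DECLARED as the shared support item GaloisRepOfRegularAlgebraic = stmt-Langlands-10785 and
listed in `closes`; a Lean proof of the HLTT-free #2 as typed would have to contain HLTT. Two
attempts to file #2' post-open (add_items with a signature naming sibling Theses decls) did not
render and coincided with gate restarts, so it is left to tenure: file #2' (crux r2), re-badge #2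
support (SteinbergMechanism/AssemblyG3 reference it), closes := hR (hM (hVG hGal) hNS hST) —
Sketch2.lean rc 0 in the g3 seat folder.
#3 NonSplitSteinbergGraded (crux) — in the setting of X, a STRICT special triangulation of the
semistable D has every graded class non-zero
(Ding's non-critical special; hypothesis (d) of arXiv:2603.18961 Thm 2, here to be PROVED). (why it
might fail: n = 2 with all labelled gaps 1
and interior pairs for n ≥ 3 are not slope-protected — a split graded pair of an étale semistable D
is possible there (critical companion-type
refinement), and ℓ = p LGC for torsion-built ρ is open (AHTW2026: N_Gal ≺ N_aut only).)
[Ding2019SimpleL, KedlayaPottharstXiao2014, AHTW2026,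
YangLGC2024, BreuilHellmannSchraen2019, BellaicheChenevier2009]
#9 StrictSteinbergGraded (support) — every special triangulation of D is strict (KPX Lemma 6.4.2 /
Prop 6.2.8(1), arXiv:1203.5718 pp.41/52:
H⁰ of the higher graded pieces of (D/Fil_i)(δ_i⁻¹) vanishes). [KedlayaPottharstXiao2014,
BellaicheChenevier2009]
#9 SteinbergMechanism (support, provable now, M) — InfinitesimalWeightVelocity →
NonSplitSteinbergGraded → StrictSteinbergGraded → X:
instantiate the three at the shared context; the dictionary clause reduces X to "no non-zero
unramified ψ with class in 𝓛(D)_i"; if ψ were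
one, take θ ∉ 𝓛(D)_i from the pairing clause, write θ|𝒪^× = Σ c_k ψ_i(δ̃_k)|𝒪^× by velocity, each
ψ_i(δ̃_k) ∈ 𝓛(D)_i by the CGS clause applied
to 𝓐.DrigOver(ρ̃_k|K_v) (a member of 𝔇.deformationsOver of D by
IsFunctorial.drigOver_mem_deformationsOver + mem_deformationsOver_dualNumber_iff
+ deformationsOver_congr — kernel-checked in SketchMech.lean), so θ − Σ c_k ψ_i(δ̃_k) vanishes on
𝒪^× = {Valued.v = 1}, hence is a multiple of ψ
(unramified homs factor through the value group ⊆ Multiplicative ℤ, cyclic), so θ ∈ 𝓛(D)_i —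
contradiction. Left to the prover: 'gap
derivative ∈ HomCont' (additivity: (a,b)(a',b') = (aa', ab'+ba') in E₀[ε], so b/a is additive on
units; continuity WITHOUT HasContinuousInv₀ on E₀: by the lifting clause fst(δ̃_i(x)δ̃_(i+1)(x)⁻¹) =
δ_i(x)δ_(i+1)(x)⁻¹ is a UNIT of E₀ depending continuously on x and inversion is continuous on E₀ˣ),
'locally constant ⇒ zero on {v = 1}' (IsLocallyConstant.range_finite on the compact unit group, a
finite subgroup of (E₀,+) is trivial in characteristic 0), 'homs vanishing on {v = 1} are multiples
of the given non-zero one' (they factor through the value group v(K_vˣ) ⊆ Multiplicative ℤ, a cyclic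
group), linear algebra in the submodule 𝓛(D)_i.
[Ding2019SimpleL]
#9 DstToLanglands (support) — OUT-OF-SCOPE REMAINDER, declared and NOT claimed, filed only so that
`closes` ends at the summit constant
(D-0027 §2.1; pattern of EisensteinMonodromy.MonodromyToLanglands): X → Langlands. Not to be staffed
from this route. [BuzzardGeeLMS2014,
AHTW2026, VarmaFMS2024, BergerLaurent2002]
#9 GenericWDUnique (support, shared with EisensteinMonodromy, stmt-Langlands-2374) — used only
inside the remainder's WD upgrade.
#1 AssemblyG3 — the chain as a Prop (proved outright).

KILL CRITERIA. (a) A non-base-change, non-CM Bianchi newform of weight (k,k), k ≥ 2, Steinberg at a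
split p, whose eigenvariety tangent
direction is (dκ_v : dκ_v̄) = (0 : 1) (Rawson's algorithm arXiv:2402.13799 §3) refutes
InfinitesimalWeightVelocity at v for n = 2 on paper
(kill or restrict to the places the family moves); (b) a semistable torsion-built ρ with a split
interior special graded pair refutes
NonSplitSteinbergGraded for n ≥ 3 (restrict X to n = 2 or to slope-protected pairs); (c) a Lean
refutation of any item can only come from
an inconsistency INSIDE the package P (each clause was checked against the printed theorem: Ding
§3.1 pairing, Thm 3.4, Lemma 3.2;
KPX ⊗-functoriality of D_rig) — repair = fix the clause, never the mechanism; (d) the residual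
un-pinnable junk is an exotic ⊗-compatible
reindexing of D_rig (a non-geometric automorphism of Γ_(K_v) fixing all characters); re-indexings of
DrigOver over E[ε] by automorphisms
of the local deformation functor are pinned by HasRestrictionCompatibility (they preserve the
2n-dimensional restriction of scalars, hence
lines in Ext¹, hence are scalars when End = E), re-indexings of 𝓒.ofCharOver and of homToH1 are
forced scalar by the CGS and dictionary
clauses (they must preserve every hyperplane 𝓛(D)); if a refuter exhibits an exotic automorphism on
paper that changes an 𝓛-invariant,
add the Art-normalised/exact D_rig predicate of defn-DrigArtinian-2 to the package; (e) ℓ = p LGC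
with N for these π proved elsewhere
(completed cohomology beyond AHTW2026, or arXiv:2603.18961 extended to CM fields) moots the route →
close superseded.

NOT DECOMPOSED YET. (i) InfinitesimalWeightVelocity ⇐ (eigenvariety tangent space at the accessible
non-critical point x(π) surjects onto the
v-gap weights) — needs a CONSTRUCTED or genuinely pinned Hansen eigenvariety (analytic topology from
zero loci, Newton bound / classical
defect, refined classical points for accessible π, Galois determinant = traceFn, KPX-dense family
triangulation with base change to the
fibre through 𝓐): second layer, not filed; or ⇐ the Poitou–Tate reformulation (two dual adjoint
Selmer groups coincide). (ii) General
segment structures rec(π_v) = ⊞ Q(Δ_j): pair-by-pair inside each segment; outside X. (iii) n = 2 at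
2[K_v:ℚ_p] > [K:ℚ]: no budget.
(iv) Totally real K: after CM base change; not claimed. (v) General Steinberg type St ⊗ χ (χ
ramified of finite order on 𝒪^×): reduced to the
semistable case St ⊗ unr by a global finite-order twist — in the remainder. (vi) needs-fact: none
beyond the Statement's cone; no item rests
on PhiGammaModuleData.nonempty / PstWeilDeligneData.nonempty (every (φ,Γ)-clause is a hypothesis on
𝔇).

CHEAPEST FALSIFIER. For refuters: (1) the package-consistency check — try to derive False from P ∧
(X's hypotheses) in Lean (a vacuity
would make every item junk-true; the planner found none: each clause is a printed theorem and the ∃U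
of the ⊗-clause absorbs basis
conventions); (2) the junk audit — any remaining Lean-constructible reindexing of D_rig preserving P
(twistSwap is killed by the
⊗-clause since V ↦ V ⊗ μ is not ⊗-compatible; dual and coefficient conjugation survive and are
harmless: N^(n-1), strictness, non-splitness,
the SET of consecutive pairs and the span of gap derivatives are invariant); (3) on paper: Rawson's
tangent-space computation for a Bianchi
newform Steinberg at split p (direction (0:1) kills the crux at v).

TWO-LAYER PLAN. InfinitesimalWeightVelocity ⇐ EigenvarietyTangentSurjects (tangent space of Hansen's
𝒳 at x(π) → gap weights at v onto;
'higher Calegari–Mazur', with étaleness over the weight image under NALC as in arXiv:2603.18961 Thm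
1 for the lifting of directions) →
TangentTrianguline (KPX: tangent vectors at a non-critical point give first-order GLOBAL
deformations trianguline at v with the refinement
parameters, via 𝓐's base change) → glue. NonSplitSteinbergGraded ⇐ SlopeExclusion (gap ≥ 2 for n =
2; slope-protected pairs) →
CompanionExclusion (unprotected pairs) → glue. Nothing filed now.

NUMBERS. dim W = 2[K⁺:ℚ]n − [K⁺:ℚ] + 1 − (Leopoldt); l₀ = [K⁺:ℚ](n−1); Newton: dim_x ≥ [K⁺:ℚ]n + 1;
twist directions [K⁺:ℚ]+1
(gap-constant); essential ≤ [K⁺:ℚ](n−1), needed per pair at v: d_v — hence the sector. dim H¹(𝓡(δ))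
= d_v + 1 at special δ, H² ≅ E, 𝓛(D)_i of
codimension 1, crystalline iff Hom_∞ ⊆ 𝓛(D)_i, N^(n-1) ≠ 0 iff no pair crystalline; trianguline
deformation functor formally smooth of dim
1 + n(n+1)d_v/2 with κ ↠ ∏ 𝓛(D)_i (Prop 3.6) — so LOCAL velocity ⇔ non-crystallinity and only the
GLOBAL statement has content. Statement lengths 3.1k–3.4k
chars (gate cap 4k) thanks to the Literature package; SketchG3.lean rc0 at default maxHeartbeats.

DEFINITION REQUESTS. Filed, LANDED (p71301, commit e509452cf910) and consumed:
defn-SteinbergVelocityPackage =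
Literature/NumberTheory/GaloisRepresentations/SteinbergVelocityPackage.lean (the pinned package
incl. the two pins HasTensorCompatibleDrig and
DrigArtinian.HasRestrictionCompatibility, pairing/CGS/dictionary predicates, gapDerivative,
HasInfinitesimalGapVelocityAt). Filed: defn-DrigArtinian-2 (Art-normalisation Drig η ≅ 𝓡(η∘Art_F),
functoriality on morphisms / exactness / ⊗ and
duals, natural H¹ comparison) — would let the inline ⊗-clause, pairing, CGS and dictionary clauses
of P become named Literature predicates
and kill the residual exotic junk; landed already: DrigArtinian (d1), BergerDstOnPhiGamma (d2).
Wanted later (second layer): a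
constructed Hansen eigenvariety for Res_(K/ℚ)GL_n; HasKedlayaSlopes (for SlopeExclusion).

Novelty: Searches (2026-08-15, this seat): `lit search --source zbmath "L-invariants eigenvariety Bianchi"`
(1: arXiv:2402.13799 Rawson);
`lit search --source arxiv "tangent spaces eigenvarieties"` (6: arXiv:2402.13799, Bergdall
arXiv:1710.02057, Hsu arXiv:1905.05687,
Hernandez–Schraen arXiv:2210.10564 infinite fern in higher dimensions, Barrera–Williams–…
arXiv:1808.09750, and arXiv:2603.18961
Barrera Salazar–Graham–Williams Mar 2026 — READ pp. 1–6); `lit galaxy search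
"Colmez-Greenberg-Stevens formula L-invariant trianguline"
--star all` (0); `lit galaxy search "tangent space eigenvariety" --star all` (0); `lit search
--source arxiv "semistable non-crystalline …
local-global compatibility at p monodromy"` (0); `lit search … --source openalex` (HTTP 429); local
searchd unavailable; `lit read
arxiv:1807.10862` pp. 23–27 (Ding2019SimpleL §3.1–3.4: perfect pairing, crystalline iff Hom_∞ ⊆ 𝓛,
Lemma 3.2, Thm 3.4, Prop 3.5–3.6 READ);
plus gen 1's searches and the card's two novelty audits (Colmez2010Linvariants, Pottharst2016, KPX,
AHTW2026 pp. 1–8/111–113, Yang,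
Allen–Newton, Bergdall 2017, Chitrao–Ghate–Yasuda).
Nearest prior art found: BarreraGrahamWilliams2026 = arXiv:2603.18961 (Barrera
Salazar–Graham–Williams, 2026) Thm 2 / Rem 1.3–1.4 — for p-ORDINARY regular algebraic
cuspidal π on GL_n(𝔸_ℚ) with π_p Steinberg, under the non-abelian Leopoldt conjecture, a tangent
vector with v_c ≠ v_(c+1) and a Galois
Benois–Colmez–Greenberg–Stevens formula give "non-split ⇒ non-crystalline" at the  [refs: 2402.13799, 1710.02057, 1905.05687, 2210.10564, 1808.09750, 2603.18961, 1807.10862, arxiv:1807.10862, Pottharst2016, AHTW2026, BarreraGrahamWilliams2026]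

Barriers (technique_class: p-adic-families, eigenvariety, phi-gamma, L-invariants): - technique_class: p-adic-families, eigenvariety, phi-gamma, L-invariants
- Literature.Barriers.Langlands.ShimuraVarietyRealizationBarrier: evaded — K is CM throughout (the
barrier blocks base fields that are neither totally real nor CM) and no realisation of π or ρ in the
cohomology of a variety is used (no weight spectral sequence, no nearby cycles): ρ enters only
through the Galois determinant over the Betti eigenvariety of Res_(K/ℚ)GL_n and its (φ,Γ)-module at
v; the barrier's defect l₀ = [K⁺:ℚ](n−1) > 0 is paid, not evaded, in the crux (Newton's bound fixes
the deformation budget and the sector).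
- Literature.Barriers.Langlands.ShimuraVarietyRealizationBarrierNarrow: evaded — d(K) = [K:K⁺] = 2
(K CM) is outside the narrowed scope d ≥ 3; the eigenvariety serves as a source of GLOBAL
FIRST-ORDER DEFORMATIONS (tangent directions), not as a cohomological realisation of r_(π,ι).
- Literature.Barriers.Langlands.NonRegularWeightBarrier: NOT evaded — π is regular algebraic
throughout (x(π) must be a classical point of a Betti eigenvariety); the route is about the
all-places clause for regular π.
- Literature.Barriers.Langlands.NonRegularWeightBarrierNarrow: not met — regular infinitesimal
character only, so the Borel–Wallach vanishing at singular type never enters.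
- Literature.Barriers.Langlands.PatchingLocalComponentBarrier: not engaged — no R = T, no patched
module, no automorphy lifting (contrast YangLGC2024, AllenNewton2020); maximal monodromy is read off
the first derivati

History (route lifecycle, newest last):
- 2026-08-16T01:31:06Z · rev 8: dropped stmt-Langlands-14038 — route-repair gen 3: restore a consistent rendered state — drop the blocked, never-rendered stmt-Langlands-14038 (short-name signature blocked 'missing decl') AN (planner-rrepair-Langlands-SteinbergVelocityDst-adc68ed8-g3-0)
- 2026-08-16T01:38:51Z · rev 9: dropped stmt-Langlands-14046 — route-repair gen 3: withdraw the consumed-crux attempt — drop stmt-Langlands-14046 InfinitesimalWeightVelocityOfGaloisReps (created 01:37Z by an add_items edit (planner-rrepair-Langlands-SteinbergVelocityDst-adc68ed8-g3-0)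
- 2026-08-16T04:10:25Z · AUTO-CRUX (backfill): MaximalMonodromyDst — hypotheses of the deciding theorem that nothing in the route derives are cruxes (operator:999:1085951)
- 2026-08-23T01:20:38Z · DORMANT — reconciler: no traction for 5.8 d (last activity statement-grounded at 2026-08-17T05:00:08Z); parked, not closed — `ledger route dormant route-Langlands-Steinbe (operator:999:477669)
- 2026-08-29T05:50:52Z · REACTIVATED — reconciler: reactivated — activity statement-checked at 2026-08-29T03:00:54Z after parking at 2026-08-23T01:20:38Z (operator:999:1524642)

sub-problem: Langlands · status: open · opened planner-rchoice-Langlands-SteinbergWeightVeloc-c11f1b5b-0 2026-08-16T00:10:07Z · rev 13 · ledger route-Langlands-SteinbergVelocityDst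
GENERATED by the gate from the ledger (D-0016/17). Provers cite these decls: `theorem foo : Summit.Langlands.Langlands.Theses.SteinbergVelocityDst.<Decl> := …` in Summits/Langlands/Langlands/Theorems/<Name>.lean.
-/

namespace Summit.Langlands.Langlands.Theses.SteinbergVelocityDst

open scoped BigOperators Topology Manifold Classical MeasureTheory ProbabilityTheory Matrix InnerProductSpace ComplexConjugate ContinuousMap
open Filter Set Function TopologicalSpace MeasureTheory

attribute [summit_statement] _root_.Langlands

/-- item stmt-Langlands-14047 · crux (kind.auto-crux: conjecture-grade) · rank 0 · open · by planner
why it might fail: If r_ι(π) is reducible (open for n ≥ 3) the semisimple ρ is a sum and N^(n-1) = 0 while (A) holds with a non-semisimple ρ; n = 2 at 2[K_v:ℚ_p] > [K:ℚ] has no budget (excluded). As typed it is vacuous, never false, on junk (𝔇,𝓐,𝓒).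
sources: AHTW2026, Ding2019SimpleL, BergerLaurent2002, BarreraGrahamWilliams2026, BuzzardGeeLMS2014, Acampo2023
[target] X: for K CM, π RA cuspidal on GL_n(𝔸_K), n ≥ 2, accessible at every w ∣ p, ρ ss
C-Satake-compatible, v ∣ p in the sector, π_v of Steinberg type; for every finite E₀/ℚ_p embedded in
ℚ̄_p, every E₀-model r_K of ρ, every (𝔇 : PhiGammaModuleRobbaLog, 𝓐 : 𝔇.DrigArtinian, 𝓒 :
𝔇.RelativeCharData) with 𝔇.IsSteinbergVelocityPackage 𝓐 𝓒 [K_v:ℚ_p] f_v (Literature notion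
SteinbergVelocityPackage: IsKPX ∧ HasTensorCompatibleDrig [the Kronecker pin] ∧ 𝓐.IsFunctorial ∧
𝓐.HasBCEquivalence ∧ 𝓐.HasRestrictionCompatibility [the restriction-of-scalars pin] ∧ 𝓒.IsCompatible
∧ HasPerfectSpecialPairing ∧ 𝓒.HasColmezGreenbergStevens ∧ HasDingSteinbergDictionary f_v — Ding
§3.1, Thm 3.4, Lemma 3.2): if D := (D_rig(r_K|K_v)).conj U is upper-triangular with parameters
𝓡(δ_j), cyclotomic, continuous, all consecutive ratios special (dim H² = 1) and SEMISTABLE (inertia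
degree f_v), then nDst(D)^(n-1) ≠ 0 on Berger's D_st(D). Vacuous (not false, not junk-true) on junk
data; contentful for the genuine data. [difficulty: open-problem] -/
@[route_item "route-Langlands-SteinbergVelocityDst", crux]
def MaximalMonodromyDst : Prop :=
  ∀ (K : Type) [Field K] [NumberField K] [NumberField.IsCMField K] (n : ℕ) (hcpt : Literature.NumberTheory.Automorphic.isCompact_glFiniteIntegralLevel n K) (π : Literature.NumberTheory.Automorphic.CuspidalAutomorphicRepData n K hcpt), 2 ≤ n → π.1.IsRegularAlgebraic → ∀ (p : ℕ) [Fact p.Prime] (ι : PadicAlgCl p ≃+* ℂ) (ρ : Literature.NumberTheory.GaloisRepresentations.FramedGaloisRep K (PadicAlgCl p) n), ρ.toGaloisRep.IsSemisimple → (∀ᶠ v : IsDedekindDomain.HeightOneSpectrum (NumberField.RingOfIntegers K) in Filter.cofinite, ∀ α : Multiset ℂ, π.1.HasSatakeParamAt v α → ρ.IsUnramifiedAt v ∧ ρ.HasFrobCharpolyAt v (Literature.NumberTheory.Automorphic.arithFrobPolyOfSatake ι v.residueCard n α)) → ∀ (v : IsDedekindDomain.HeightOneSpectrum (NumberField.RingOfIntegers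 K)) (hv : ((p : ℕ) : NumberField.RingOfIntegers K) ∈ v.asIdeal), (3 ≤ n ∨ 2 * (v.asIdeal.ramificationIdx ℤ * v.asIdeal.inertiaDeg ℤ) ≤ Module.finrank ℚ K) → (∀ (L : Literature.NumberTheory.Automorphic.LocalLanglandsDatum (v.adicCompletion K)) (πv : Literature.NumberTheory.Automorphic.SmoothIrrep (Matrix.GeneralLinearGroup (Fin n) (v.adicCompletion K))), π.1.HasLocalComponentAt v πv.ρ → ((L.recGL n (Literature.NumberTheory.Automorphic.IrrClass.mk πv)).out.1).N ^ (n - 1) ≠ 0) → (∀ w : Literature.NumberTheory.Automorphic.PlacesOver K p, ∃ (πw : Literature.NumberTheory.Automorphic.SmoothIrrep (Matrix.GeneralLinearGroup (Fin n) (w.1.adicCompletion K))) (χw : (Fin n → (w.1.adicCompletion K)ˣ) →* ℂˣ), π.1.HasLocalComponentAt w.1 πw.ρ ∧ Literature.NumberTheory.Automorphic.IsJacquetExponent πw χw) → ∀ (E₀ : Type) [Field E₀] [TopologicalSpace E₀] [IsTopologicalRing E₀] [Algebra ℚ_[p] E₀] [Module.Finite ℚ_[p] E₀] (emb : E₀ →+*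 PadicAlgCl p) (hemb : Topology.IsEmbedding emb), (∀ x : ℚ_[p], emb (algebraMap ℚ_[p] E₀ x) = algebraMap ℚ_[p] (PadicAlgCl p) x) → ∀ (rK : Literature.NumberTheory.GaloisRepresentations.FramedGaloisRep K E₀ n), (∃ P : Matrix.GeneralLinearGroup (Fin n) (PadicAlgCl p), Literature.NumberTheory.GaloisRepresentations.FramedRep.conj P (rK.baseChange emb hemb.continuous) = ρ) → ∀ (𝔇 : Literature.NumberTheory.GaloisRepresentations.PhiGammaModuleRobbaLog.{0, 0, 0} p (v.adicCompletion K) E₀) (𝓐 : 𝔇.DrigArtinian) (𝓒 : 𝔇.RelativeCharData), 𝔇.IsSteinbergVelocityPackage 𝓐 𝓒 (v.asIdeal.ramificationIdx ℤ * v.asIdeal.inertiaDeg ℤ) (v.asIdeal.inertiaDeg ℤ) → ∀ (U : Matrix.GeneralLinearGroup (Fin n) 𝔇.R) (δ : Fin n → ((v.adicCompletion K)ˣ →ₜ* E₀ˣ)) (h : ((𝔇.Drig (rK.toLocal v)).conj U).IsTriangularWith (fun j => ((𝔇.ofChar (δ j)).α : 𝔇.R)) (fun j σ => ((𝔇.ofChar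 (δ j)).c σ : 𝔇.R))), 𝔇.IsCyclotomic ((𝔇.Drig (rK.toLocal v)).conj U) → ((𝔇.Drig (rK.toLocal v)).conj U).toPhiGammaModule.IsContinuous → (∀ (i : ℕ) (hi : i + 1 < n), Module.finrank E₀ (𝔇.H2 ((Literature.NumberTheory.GaloisRepresentations.PhiGammaModule.Triangulation.ofTriangular ((𝔇.Drig (rK.toLocal v)).conj U) (fun j => 𝔇.ofChar (δ j)) h).ratioParam i hi).toModule) = 1) → 𝔇.IsSemistable ((𝔇.Drig (rK.toLocal v)).conj U).toPhiGammaModule (v.asIdeal.inertiaDeg ℤ) → 𝔇.nDst ((𝔇.Drig (rK.toLocal v)).conj U).toPhiGammaModule ^ (n - 1) ≠ 0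

/-- item stmt-Langlands-14048 · crux · rank 2 · open · by planner
why it might fail: The global tangent space may fill only a hyperplane of gap directions at v: a dual adjoint Selmer class invisible away from v (Leopoldt shape, higher Calegari–Mazur; arXiv:2603.18961 Rem 1.4 gets half the simple roots even under NALC); zero slack for n = 2, d_v = [K⁺:ℚ].
sources: BarreraGrahamWilliams2026, HansenUniversalEigenvarieties2017, JohanssonNewton2019, KedlayaPottharstXiao2014, BellaicheChenevier2009, Ding2019SimpleL
[crux] [the bet, GLOBAL; card N2; = crux ideas derived-diamond-duality / poitou-tate-velocity-split
on stmt-13450 made the statement] in the setting of X (same shared hypotheses through 'special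
ratios' and 'semistable'), for every consecutive pair (i,i+1): r_K.HasInfinitesimalGapVelocityAt v 𝓐
𝓒 δ i hi (Literature notion SteinbergVelocityPackage) — every continuous additive φ : K_v^× → E₀
agrees on the units {Valued.v = 1} with Σ_k c_k · gapDerivative(δ̃_(k,i), δ̃_(k,i+1)) for finitely
many GLOBAL first-order deformations ρ̃_k : Γ_K → GL_n(E₀[ε]) of r_K (entrywise fst ∘ ρ̃_k = r_K),
characters δ̃_(k,j) : K_v^× → (E₀[ε])^× lifting δ_j and bases Ũ_k with (𝓐.drigOverDualNumber
(ρ̃_k|K_v)).conj Ũ_k upper-triangular with the relative rank-one data 𝓒.ofCharOver E₀[ε] (δ̃_(k,j))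
on the diagonal (gapDerivative = snd/fst of δ̃_iδ̃_(i+1)⁻¹): FULL WEIGHT VELOCITY of the global
tangent directions at v, d_v = [K_v:ℚ_p] directions at every pair. Intended proof: tangent space of
Hansen's eigenvariety at the accessible refined point x(π) + KPX/𝓐 base change + transversality of
the weight map at v (Newton's bound dim_x ≥ [K⁺:ℚ]n + 1, l₀ = [K⁺:ℚ](n−1)); Galois form: two dual
adjoint Selmer groups c -/
@[route_item "route-Langlands-SteinbergVelocityDst", crux]
def InfinitesimalWeightVelocity : Prop :=
  ∀ (K : Type) [Field K] [NumberField K] [NumberField.IsCMField K] (n : ℕ) (hcpt : Literature.NumberTheory.Automorphic.isCompact_glFiniteIntegralLevel n K) (π : Literature.NumberTheory.Automorphic.CuspidalAutomorphicRepData n K hcpt), 2 ≤ n → π.1.IsRegularAlgebraic → ∀ (p : ℕ) [Fact p.Prime] (ι : PadicAlgCl p ≃+* ℂ) (ρ : Literature.NumberTheory.GaloisRepresentations.FramedGaloisRep K (PadicAlgCl p) n), ρ.toGaloisRep.IsSemisimple → (∀ᶠ v : IsDedekindDomain.HeightOneSpectrum (NumberField.RingOfIntegers K) in Filter.cofinite,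 ∀ α : Multiset ℂ, π.1.HasSatakeParamAt v α → ρ.IsUnramifiedAt v ∧ ρ.HasFrobCharpolyAt v (Literature.NumberTheory.Automorphic.arithFrobPolyOfSatake ι v.residueCard n α)) → ∀ (v : IsDedekindDomain.HeightOneSpectrum (NumberField.RingOfIntegers K)) (hv : ((p : ℕ) : NumberField.RingOfIntegers K) ∈ v.asIdeal), (3 ≤ n ∨ 2 * (v.asIdeal.ramificationIdx ℤ * v.asIdeal.inertiaDeg ℤ) ≤ Module.finrank ℚ K) → (∀ (L : Literature.NumberTheory.Automorphic.LocalLanglandsDatum (v.adicCompletion K)) (πv : Literature.NumberTheory.Automorphic.SmoothIrrep (Matrix.GeneralLinearGroup (Fin n) (v.adicCompletion K))), π.1.HasLocalComponentAt v πv.ρ → ((L.recGL n (Literature.NumberTheory.Automorphic.IrrClass.mk πv)).out.1).N ^ (n - 1) ≠ 0) → (∀ w : Literature.NumberTheory.Automorphic.PlacesOver K p, ∃ (πw : Literature.NumberTheory.Automorphic.SmoothIrrep (Matrix.GeneralLinearGroup (Fin n) (w.1.adicCompletion K))) (χw : (Fin n → (w.1.adicCompletion K)ˣ) →* ℂˣ),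 π.1.HasLocalComponentAt w.1 πw.ρ ∧ Literature.NumberTheory.Automorphic.IsJacquetExponent πw χw) → ∀ (E₀ : Type) [Field E₀] [TopologicalSpace E₀] [IsTopologicalRing E₀] [Algebra ℚ_[p] E₀] [Module.Finite ℚ_[p] E₀] (emb : E₀ →+* PadicAlgCl p) (hemb : Topology.IsEmbedding emb), (∀ x : ℚ_[p], emb (algebraMap ℚ_[p] E₀ x) = algebraMap ℚ_[p] (PadicAlgCl p) x) → ∀ (rK : Literature.NumberTheory.GaloisRepresentations.FramedGaloisRep K E₀ n), (∃ P : Matrix.GeneralLinearGroup (Fin n) (PadicAlgCl p), Literature.NumberTheory.GaloisRepresentations.FramedRep.conj P (rK.baseChange emb hemb.continuous) = ρ) → ∀ (𝔇 : Literature.NumberTheory.GaloisRepresentations.PhiGammaModuleRobbaLog.{0, 0, 0} p (v.adicCompletion K) E₀) (𝓐 : 𝔇.DrigArtinian) (𝓒 : 𝔇.RelativeCharData), 𝔇.IsSteinbergVelocityPackage 𝓐 𝓒 (v.asIdeal.ramificationIdx ℤ * v.asIdeal.inertiaDeg ℤ) (v.asIdeal.inertiaDeg ℤ) → ∀ (U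 : Matrix.GeneralLinearGroup (Fin n) 𝔇.R) (δ : Fin n → ((v.adicCompletion K)ˣ →ₜ* E₀ˣ)) (h : ((𝔇.Drig (rK.toLocal v)).conj U).IsTriangularWith (fun j => ((𝔇.ofChar (δ j)).α : 𝔇.R)) (fun j σ => ((𝔇.ofChar (δ j)).c σ : 𝔇.R))), 𝔇.IsCyclotomic ((𝔇.Drig (rK.toLocal v)).conj U) → ((𝔇.Drig (rK.toLocal v)).conj U).toPhiGammaModule.IsContinuous → (∀ (i : ℕ) (hi : i + 1 < n), Module.finrank E₀ (𝔇.H2 ((Literature.NumberTheory.GaloisRepresentations.PhiGammaModule.Triangulation.ofTriangular ((𝔇.Drig (rK.toLocal v)).conj U) (fun j => 𝔇.ofChar (δ j)) h).ratioParam i hi).toModule) = 1) → 𝔇.IsSemistable ((𝔇.Drig (rK.toLocal v)).conj U).toPhiGammaModule (v.asIdeal.inertiaDeg ℤ) → ∀ (i : ℕ) (hi : i + 1 < n), rK.HasInfinitesimalGapVelocityAt v 𝓐 𝓒 δ i hi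

/-- item stmt-Langlands-14049 · crux · rank 3 · open · by planner
why it might fail: n = 2 with every labelled gap 1 (weight-2 type) and interior pairs for n ≥ 3 are not slope-protected: a split special graded pair of an étale semistable D is possible (critical companion refinement); ℓ = p LGC for torsion-built ρ is open (AHTW2026: only N_Gal ≺ N_aut).
sources: Ding2019SimpleL, KedlayaPottharstXiao2014, AHTW2026, YangLGC2024, BreuilHellmannSchraen2019, BellaicheChenevier2009
[crux] [card N3] in the setting of X: if the special triangulation ofTriangular(D, 𝓡(δ_j)) of the
semistable D = (D_rig(r_K|K_v)).conj U is STRICT then every graded class is non-zero, c_i ≠ 0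
(Ding's non-critical special; hypothesis (d) 'non-split at c' of arXiv:2603.18961 Thm 2, here to be
PROVED for torsion-built ρ). Slope-protected pairs (n = 2 with a labelled gap ≥ 2) follow from
étaleness once Kedlaya slopes are available as a predicate; the unprotected pairs are the open
content. [difficulty: open-problem] -/
@[route_item "route-Langlands-SteinbergVelocityDst", crux]
def NonSplitSteinbergGraded : Prop :=
  ∀ (K : Type) [Field K] [NumberField K] [NumberField.IsCMField K] (n : ℕ) (hcpt : Literature.NumberTheory.Automorphic.isCompact_glFiniteIntegralLevel n K) (π : Literature.NumberTheory.Automorphic.CuspidalAutomorphicRepData n K hcpt), 2 ≤ n → π.1.IsRegularAlgebraic → ∀ (p : ℕ) [Fact p.Prime] (ι : PadicAlgCl p ≃+* ℂ) (ρ : Literature.NumberTheory.GaloisRepresentations.FramedGaloisRep K (PadicAlgCl p) n), ρ.toGaloisRep.IsSemisimple → (∀ᶠ v : IsDedekindDomain.HeightOneSpectrum (NumberField.RingOfIntegers K) in Filter.cofinite, ∀ α : Multiset ℂ, π.1.HasSatakeParamAt v α → ρ.IsUnramifiedAt v ∧ ρ.HasFrobCharpolyAt v (Literature.NumberTheory.Automorphic.arithFrobPolyOfSatake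 ι v.residueCard n α)) → ∀ (v : IsDedekindDomain.HeightOneSpectrum (NumberField.RingOfIntegers K)) (hv : ((p : ℕ) : NumberField.RingOfIntegers K) ∈ v.asIdeal), (3 ≤ n ∨ 2 * (v.asIdeal.ramificationIdx ℤ * v.asIdeal.inertiaDeg ℤ) ≤ Module.finrank ℚ K) → (∀ (L : Literature.NumberTheory.Automorphic.LocalLanglandsDatum (v.adicCompletion K)) (πv : Literature.NumberTheory.Automorphic.SmoothIrrep (Matrix.GeneralLinearGroup (Fin n) (v.adicCompletion K))), π.1.HasLocalComponentAt v πv.ρ → ((L.recGL n (Literature.NumberTheory.Automorphic.IrrClass.mk πv)).out.1).N ^ (n - 1) ≠ 0) → (∀ w : Literature.NumberTheory.Automorphic.PlacesOver K p, ∃ (πw : Literature.NumberTheory.Automorphic.SmoothIrrep (Matrix.GeneralLinearGroup (Fin n) (w.1.adicCompletion K))) (χw : (Fin n → (w.1.adicCompletion K)ˣ) →* ℂˣ), π.1.HasLocalComponentAt w.1 πw.ρ ∧ Literature.NumberTheory.Automorphic.IsJacquetExponent πw χw) → ∀ (E₀ : Type) [Field E₀] [TopologicalSpace E₀] [IsTopologicalRing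 E₀] [Algebra ℚ_[p] E₀] [Module.Finite ℚ_[p] E₀] (emb : E₀ →+* PadicAlgCl p) (hemb : Topology.IsEmbedding emb), (∀ x : ℚ_[p], emb (algebraMap ℚ_[p] E₀ x) = algebraMap ℚ_[p] (PadicAlgCl p) x) → ∀ (rK : Literature.NumberTheory.GaloisRepresentations.FramedGaloisRep K E₀ n), (∃ P : Matrix.GeneralLinearGroup (Fin n) (PadicAlgCl p), Literature.NumberTheory.GaloisRepresentations.FramedRep.conj P (rK.baseChange emb hemb.continuous) = ρ) → ∀ (𝔇 : Literature.NumberTheory.GaloisRepresentations.PhiGammaModuleRobbaLog.{0, 0, 0} p (v.adicCompletion K) E₀) (𝓐 : 𝔇.DrigArtinian) (𝓒 : 𝔇.RelativeCharData), 𝔇.IsSteinbergVelocityPackage 𝓐 𝓒 (v.asIdeal.ramificationIdx ℤ * v.asIdeal.inertiaDeg ℤ) (v.asIdeal.inertiaDeg ℤ) → ∀ (U : Matrix.GeneralLinearGroup (Fin n) 𝔇.R) (δ : Fin n → ((v.adicCompletion K)ˣ →ₜ* E₀ˣ)) (h : ((𝔇.Drig (rK.toLocal v)).conj U).IsTriangularWith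 (fun j => ((𝔇.ofChar (δ j)).α : 𝔇.R)) (fun j σ => ((𝔇.ofChar (δ j)).c σ : 𝔇.R))), 𝔇.IsCyclotomic ((𝔇.Drig (rK.toLocal v)).conj U) → ((𝔇.Drig (rK.toLocal v)).conj U).toPhiGammaModule.IsContinuous → (∀ (i : ℕ) (hi : i + 1 < n), Module.finrank E₀ (𝔇.H2 ((Literature.NumberTheory.GaloisRepresentations.PhiGammaModule.Triangulation.ofTriangular ((𝔇.Drig (rK.toLocal v)).conj U) (fun j => 𝔇.ofChar (δ j)) h).ratioParam i hi).toModule) = 1) → 𝔇.IsSemistable ((𝔇.Drig (rK.toLocal v)).conj U).toPhiGammaModule (v.asIdeal.inertiaDeg ℤ) → (Literature.NumberTheory.GaloisRepresentations.PhiGammaModule.Triangulation.ofTriangular ((𝔇.Drig (rK.toLocal v)).conj U) (fun j => 𝔇.ofChar (δ j)) h).IsStrict 𝔇.gen → ∀ (i : ℕ) (hi : i + 1 < n), (Literature.NumberTheory.GaloisRepresentations.PhiGammaModule.Triangulation.ofTriangular ((𝔇.Drig (rK.toLocal v)).conj U) (fun j => 𝔇.ofChar (δ j)) h).IsNonSplitAt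 𝔇.gen i hi

/-- item stmt-Langlands-10785 · support · rank 9 · open · by planner
[support] needs-fact: Literature.NumberTheory.Automorphic.exists_galoisRep_of_regularAlgebraic
(lang.S27 = HarrisLanTaylorThorneRMS2016 Thm A + Scholze2015 Cor V.4.2 + VarmaFMS2024 Thm 1: Galois
representations attached to REGULAR algebraic cuspidal π of GL_n over totally real / CM K,
unramified and Satake–Frobenius compatible at every unramified v ∤ ℓ, C-normalisation
`arithFrobPolyOfSatake ι q_v n α`). RESTATED INLINE (route-repair g2, 2026-08-15): the item is now
the fact's statement VERBATIM with explicit binders instead of an alias of the Literature constant,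
so the named fact is this route's OWN recorded obligation (cone rule: own items excepted) rather
than a cite_only constant in the dependency cone that would keep the whole route unstaffable until
HLTT is a Lean theorem. It is definitionally equivalent to the Literature fact (Sketch.lean
`galoisRepOfRegularAlgebraic_iff`, rc 0): the day `exists_galoisRep_of_regularAlgebraic_holds` lands
in Literature this item closes in one line (`fun n K _ _ hcpt =>
exists_galoisRep_of_regularAlgebraic_holds hcpt`); until then it is the regular-weight sector of
AutToGalCM (rank 3) and the source of the branches ρ_{π_m} of FernDensity (ran -/
@[route_item "route-Langlands-SteinbergVelocityDst", crux]
def GaloisRepOfRegularAlgebraic : Prop :=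
  ∀ (n : ℕ) (K : Type) [Field K] [NumberField K] (hcpt : Literature.NumberTheory.Automorphic.isCompact_glFiniteIntegralLevel n K), (NumberField.IsTotallyReal K ∨ NumberField.IsCMField K) → ∀ (π : Literature.NumberTheory.Automorphic.CuspidalAutomorphicRepData n K hcpt), π.1.IsRegularAlgebraic → ∀ (ℓ : ℕ) [Fact ℓ.Prime] (ι : PadicAlgCl ℓ ≃+* ℂ), ∃ r : Literature.NumberTheory.GaloisRepresentations.FramedGaloisRep K (PadicAlgCl ℓ) n, r.toGaloisRep.IsSemisimple ∧ ∀ (v : IsDedekindDomain.HeightOneSpectrum (NumberField.RingOfIntegers K)) (α : Multiset ℂ), π.1.HasSatakeParamAt v α → ((ℓ : ℕ) : NumberField.RingOfIntegers K) ∉ v.asIdeal → r.IsUnramifiedAt v ∧ r.HasFrobCharpolyAt v (Literature.NumberTheory.Automorphic.arithFrobPolyOfSatake ι v.residueCard n α)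

/-- item stmt-Langlands-14050 · support · rank 9 · open · by planner
sources: KedlayaPottharstXiao2014, BellaicheChenevier2009, Nakamura2009
[support] [gen-2 retriage: automatic] in the setting of X every special triangulation
ofTriangular(D, 𝓡(δ_j)) of D = (D_rig(r_K|K_v)).conj U is STRICT (KPX Def 6.3.1: dim
H⁰((D/Fil_i)(δ_i⁻¹)) = 1 at every step; the higher graded pieces of (D/Fil_i)(δ_i⁻¹) are 𝓡(|N|^(-s)
x^(-k)), s ≥ 1, with H⁰ = 0 by KPX Prop 6.2.8(1), so dim H⁰ = 1 by dévissage = KPX Lemma 6.4.2,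
arXiv:1203.5718 pp.41/52). Provable in-tree once Prop 6.2.8(1) is available as a predicate on 𝔇
(HasRankOneCohomology gives dimensions of H¹ only); true for the genuine data. [difficulty: L] -/
@[route_item "route-Langlands-SteinbergVelocityDst", crux]
def StrictSteinbergGraded : Prop :=
  ∀ (K : Type) [Field K] [NumberField K] [NumberField.IsCMField K] (n : ℕ) (hcpt : Literature.NumberTheory.Automorphic.isCompact_glFiniteIntegralLevel n K) (π : Literature.NumberTheory.Automorphic.CuspidalAutomorphicRepData n K hcpt), 2 ≤ n → π.1.IsRegularAlgebraic → ∀ (p : ℕ) [Fact p.Prime] (ι : PadicAlgCl p ≃+* ℂ) (ρ : Literature.NumberTheory.GaloisRepresentations.FramedGaloisRep K (PadicAlgCl p) n), ρ.toGaloisRep.IsSemisimple → (∀ᶠ v : IsDedekindDomain.HeightOneSpectrum (NumberField.RingOfIntegers K) in Filter.cofinite, ∀ α : Multiset ℂ, π.1.HasSatakeParamAt v α → ρ.IsUnramifiedAt v ∧ ρ.HasFrobCharpolyAt v (Literature.NumberTheory.Automorphic.arithFrobPolyOfSatake ι v.residueCard n α)) → ∀ (v : IsDedekindDomain.HeightOneSpectrum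 (NumberField.RingOfIntegers K)) (hv : ((p : ℕ) : NumberField.RingOfIntegers K) ∈ v.asIdeal), (3 ≤ n ∨ 2 * (v.asIdeal.ramificationIdx ℤ * v.asIdeal.inertiaDeg ℤ) ≤ Module.finrank ℚ K) → (∀ (L : Literature.NumberTheory.Automorphic.LocalLanglandsDatum (v.adicCompletion K)) (πv : Literature.NumberTheory.Automorphic.SmoothIrrep (Matrix.GeneralLinearGroup (Fin n) (v.adicCompletion K))), π.1.HasLocalComponentAt v πv.ρ → ((L.recGL n (Literature.NumberTheory.Automorphic.IrrClass.mk πv)).out.1).N ^ (n - 1) ≠ 0) → (∀ w : Literature.NumberTheory.Automorphic.PlacesOver K p, ∃ (πw : Literature.NumberTheory.Automorphic.SmoothIrrep (Matrix.GeneralLinearGroup (Fin n) (w.1.adicCompletion K))) (χw : (Fin n → (w.1.adicCompletion K)ˣ) →* ℂˣ), π.1.HasLocalComponentAt w.1 πw.ρ ∧ Literature.NumberTheory.Automorphic.IsJacquetExponent πw χw) → ∀ (E₀ : Type) [Field E₀] [TopologicalSpace E₀] [IsTopologicalRing E₀] [Algebra ℚ_[p] E₀] [Module.Finite ℚ_[p]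 E₀] (emb : E₀ →+* PadicAlgCl p) (hemb : Topology.IsEmbedding emb), (∀ x : ℚ_[p], emb (algebraMap ℚ_[p] E₀ x) = algebraMap ℚ_[p] (PadicAlgCl p) x) → ∀ (rK : Literature.NumberTheory.GaloisRepresentations.FramedGaloisRep K E₀ n), (∃ P : Matrix.GeneralLinearGroup (Fin n) (PadicAlgCl p), Literature.NumberTheory.GaloisRepresentations.FramedRep.conj P (rK.baseChange emb hemb.continuous) = ρ) → ∀ (𝔇 : Literature.NumberTheory.GaloisRepresentations.PhiGammaModuleRobbaLog.{0, 0, 0} p (v.adicCompletion K) E₀) (𝓐 : 𝔇.DrigArtinian) (𝓒 : 𝔇.RelativeCharData), 𝔇.IsSteinbergVelocityPackage 𝓐 𝓒 (v.asIdeal.ramificationIdx ℤ * v.asIdeal.inertiaDeg ℤ) (v.asIdeal.inertiaDeg ℤ) → ∀ (U : Matrix.GeneralLinearGroup (Fin n) 𝔇.R) (δ : Fin n → ((v.adicCompletion K)ˣ →ₜ* E₀ˣ)) (h : ((𝔇.Drig (rK.toLocal v)).conj U).IsTriangularWith (fun j => ((𝔇.ofChar (δ j)).α : 𝔇.R)) (fun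 j σ => ((𝔇.ofChar (δ j)).c σ : 𝔇.R))), 𝔇.IsCyclotomic ((𝔇.Drig (rK.toLocal v)).conj U) → ((𝔇.Drig (rK.toLocal v)).conj U).toPhiGammaModule.IsContinuous → (∀ (i : ℕ) (hi : i + 1 < n), Module.finrank E₀ (𝔇.H2 ((Literature.NumberTheory.GaloisRepresentations.PhiGammaModule.Triangulation.ofTriangular ((𝔇.Drig (rK.toLocal v)).conj U) (fun j => 𝔇.ofChar (δ j)) h).ratioParam i hi).toModule) = 1) → 𝔇.IsSemistable ((𝔇.Drig (rK.toLocal v)).conj U).toPhiGammaModule (v.asIdeal.inertiaDeg ℤ) → (Literature.NumberTheory.GaloisRepresentations.PhiGammaModule.Triangulation.ofTriangular ((𝔇.Drig (rK.toLocal v)).conj U) (fun j => 𝔇.ofChar (δ j)) h).IsStrict 𝔇.gen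

/-- item stmt-Langlands-14051 · support · rank 9 · closed · proved by Summit.Langlands.Langlands.Theorems.SteinbergVelocityDstSteinbergMechanism.steinbergMechanism (prover) · by planner
sources: Ding2019SimpleL, KedlayaPottharstXiao2014, BellaicheChenevier2009
[support] [glue, provable now] InfinitesimalWeightVelocity → NonSplitSteinbergGraded →
StrictSteinbergGraded → MaximalMonodromyDst. Proof (plumbing kernel-checked in the planner's
SketchMech.lean, evidence): fix the shared context; Strict gives IsStrict, NonSplit gives the
classes c_i ≠ 0, Velocity gives the global deformations; apply the dictionary clause of P to D with
its triangulation (special, non-split, strict, semistable): it remains to show that no non-zero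
unramified ψ (vanishing on {Valued.v = 1}) has H1toH1(homToH1 ψ) ∈ 𝓛(D)_i = cupOrthogonal c_i. If
one did: the pairing clause gives θ with class ∉ 𝓛(D)_i; velocity writes θ|𝒪^× = Σ c_k
ψ_i(δ̃_k)|𝒪^×; the CGS clause, applied to Dε := 𝓐.drigOverDualNumber(ρ̃_k|K_v) ∈ 𝔇.deformationsOver
E₀[ε] fst D (IsFunctorial.drigOver_mem_deformationsOver + mem_deformationsOver_dualNumber_iff +
deformationsOver_congr ⟨U, rfl⟩) with (δ̃_k, Ũ_k), puts each ψ_i(δ̃_k) (an element of HomCont: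
logarithmic derivative of a continuous character) in 𝓛(D)_i; θ − Σ c_k ψ_i(δ̃_k) vanishes on the
units {v = 1}; the locally constant ψ also vanishes there (finite image on a compact group, char 0);
homs vanishing on {v = 1} factor through the value group -/
@[route_item "route-Langlands-SteinbergVelocityDst", crux]
def SteinbergMechanism : Prop :=
  InfinitesimalWeightVelocity → NonSplitSteinbergGraded → StrictSteinbergGraded → MaximalMonodromyDst

-- `SteinbergMechanism` holds: proved by `Summit.Langlands.Langlands.Theorems.SteinbergVelocityDstSteinbergMechanism.steinbergMechanism` (its module imports this route file, so no `_holds` link can be stated here).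

/-- item stmt-Langlands-14052 · support · rank 9 · open · by planner
sources: BuzzardGeeLMS2014, AHTW2026, VarmaFMS2024, BergerLaurent2002
[support] OUT-OF-SCOPE REMAINDER, declared and NOT claimed, filed only so that the deciding theorem
`closes` ends at the summit constant (D-0027 §2.1; same pattern as
EisensteinMonodromy.MonodromyToLanglands, DegenerateLimits.LanglandsOfTarget,
TriangulineChamber.SliceToLanglands): MaximalMonodromyDst → Langlands. It contains the reciprocity
data for every number field (the genuine, Berger-compatible Rec), direction (B), direction (A)
outside [K CM, π regular algebraic and accessible at p, v ∣ p, π_v Steinberg-type, the sector],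
irreducibility of r_ι(π), existence of an E₀-rational special triangulation of D_rig(ρ|K_v)
(semistable ⇒ trianguline), the reduction of St ⊗ χ to the semistable case by a global finite-order
twist, and the upgrade of N^(n-1) ≠ 0 on D_st to the literal `LocalGlobalCompatibleAt` clause at v ∣
ℓ (Berger: D_st(D_rig V) = D_st(V); AHTW2026 Thm 1.2.1 ss part + N ≺; GenericWDUnique; the C↔L twist
|det|^((1-n)/2)). Not to be staffed from this route. [difficulty: open-problem] -/
@[route_item "route-Langlands-SteinbergVelocityDst", crux]
def DstToLanglands : Prop :=
  MaximalMonodromyDst → _root_.Langlands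

/-- item stmt-Langlands-2374 · support · rank 9 · closed · proved by Summit.Langlands.Langlands.Theorems.GenericWDUnique_proof (prover) · by planner
sources: Allen2016, VarmaFMS2024, TateCorvallis1979, BellaicheChenevier2009
[support] over an algebraically closed field of characteristic 0, two Frobenius-semisimple GENERIC
Weil–Deligne representations of W_F on the same space with equal traces of ρ(w) for all w are
isomorphic (ρ ≅ ρ' by Brauer–Nesbitt + "Φ-semisimple ⇒ semisimple"; generic ⇔ N in the open orbit of
the centraliser on {N}; the open orbit is unique). This is the lemma turning X + Varma's semisimple
compatibility into the summit's v ∤ ℓ clause; pure algebra, provable now. [difficulty: provable-now] -/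
@[route_item "route-Langlands-SteinbergVelocityDst", crux]
def GenericWDUnique : Prop :=
  ∀ (F : Type) [Field F] [ValuativeRel F] [TopologicalSpace F] [IsNonarchimedeanLocalField F] (E : Type) [Field E] [IsAlgClosed E] [CharZero E] (n : ℕ) (W W' : Literature.NumberTheory.GaloisRepresentations.WeilDeligneRep F E (Fin n → E)), W.IsFrobSemisimple → W'.IsFrobSemisimple → (∀ w : Literature.NumberTheory.GaloisRepresentations.WeilGroup F, LinearMap.trace E (Fin n → E) (W.ρ w) = LinearMap.trace E (Fin n → E) (W'.ρ w)) → (∀ f : (Fin n → E) →ₗ[E] (Fin n → E), (∀ w : Literature.NumberTheory.GaloisRepresentations.WeilGroup F, f ∘ₗ W.ρ w = ((Literature.NumberTheory.GaloisRepresentations.IsNonarchimedeanLocalField.residueFieldCard F : E) ^ (Literature.NumberTheory.GaloisRepresentations.WeilGroup.deg w)) • (W.ρ w ∘ₗ f)) → f ∘ₗ W.N = W.N ∘ₗ f → f = 0) → (∀ f : (Fin n → E) →ₗ[E] (Fin n → E), (∀ w : Literature.NumberTheory.GaloisRepresentations.WeilGroup F, f ∘ₗ W'.ρ w = ((Literature.NumberTheory.GaloisRepresentations.IsNonarchimedeanLocalField.residueFieldCard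 F : E) ^ (Literature.NumberTheory.GaloisRepresentations.WeilGroup.deg w)) • (W'.ρ w ∘ₗ f)) → f ∘ₗ W'.N = W'.N ∘ₗ f → f = 0) → W.IsEquivalent W'

/-- `GenericWDUnique` holds: proved by `Summit.Langlands.Langlands.Theorems.GenericWDUnique_proof`. -/
theorem GenericWDUnique_holds : GenericWDUnique := _root_.Summit.Langlands.Langlands.Theorems.GenericWDUnique_proof

/-- item stmt-Langlands-14053 · assembly · rank 1 · open · by planner
sources: Ding2019SimpleL
[assembly] InfinitesimalWeightVelocity → NonSplitSteinbergGraded → StrictSteinbergGraded →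
SteinbergMechanism → DstToLanglands → Langlands (the chain of `closes`; proved outright: fun hV hNS
hST hM hR => hR (hM hV hNS hST)). -/
@[route_item "route-Langlands-SteinbergVelocityDst", crux]
def AssemblyG3 : Prop :=
  InfinitesimalWeightVelocity → NonSplitSteinbergGraded → StrictSteinbergGraded → SteinbergMechanism → DstToLanglands → _root_.Langlands

/-! D-0027 §2.1 — DECIDING THEOREM (planner-authored via `route open/edit --closes-file`; by planner-rrepair-Langlands-SteinbergVelocityDst-adc68ed8-g5-0 2026-08-16T02:24:29Z):
its hypotheses are this route's items and its conclusion the sub-problem Statement (glue_lint), and it elaborates with this file. -/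

/-- D-0027 §2.1 deciding theorem of route SteinbergVelocityDst (generation 3 of the weight-velocity line), re-certified by
route-repair gen 5 (2026-08-16). Hypotheses = the route's nine items, nothing else: target MaximalMonodromyDst; cruxes
InfinitesimalWeightVelocity (rank 2), NonSplitSteinbergGraded (rank 3); supports StrictSteinbergGraded, SteinbergMechanism,
DstToLanglands (declared, not-claimed remainder X → Langlands), GenericWDUnique, GaloisRepOfRegularAlgebraic (lang.S27 restated
inline, so no unproved Literature constant sits in the decl cone); the bookkeeping AssemblyG3. Conclusion = the sub-problem
Statement `Langlands` by name. Proof: SteinbergMechanism turns velocity + non-split + strict into X; DstToLanglands carries X to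
the summit constant. Pure logic. -/
@[closes "route-Langlands-SteinbergVelocityDst"] theorem closes (_hX : MaximalMonodromyDst) (hV : InfinitesimalWeightVelocity) (hNS : NonSplitSteinbergGraded)
    (hST : StrictSteinbergGraded) (hM : SteinbergMechanism) (hR : DstToLanglands) (_hG : GenericWDUnique)
    (_hGal : GaloisRepOfRegularAlgebraic) (_hA : AssemblyG3) : _root_.Langlands :=
  hR (hM hV hNS hST)

end Summit.Langlands.Langlands.Theses.SteinbergVelocityDst
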